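import Summits.QuantumFields.BalabanUV.Beta.D1BFx.LocalGroupRow
import Summits.QuantumFields.BalabanUV.Beta.D1BFx.NeedleRowsAtRay
import Summits.QuantumFields.BalabanUV.Beta.D1BFx.GluonNeedleRowT3

/-!
# `BalabanUV.Beta.D1BFx.RoadEndGroups` — road «BF-x» for binder row D1, slot (K), «END-WIRE»: THE GROUP HYPOTHESIS `hGrp` OF THE END OF RECORD
# (`RoadEndBFxTotalShellGroups.d1Drift_BFx_total_shell_of_prop12_of_groups` at the label of record `grpRec`, via `RoadEndBFxRows.hGrp_of_rows`) WIRED FROM THE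
# THREE GROUP ROWS NOW IN THE TREE — (LOCAL) `LocalGroupRow.hLoc_of_prop12`, (N) `GluonNeedleRowsT12 ∕ GluonNeedleRowT3 ∕ NeedleRowsAtRay` (seven of eight table rows),
# (Λ) `RoadEndLamRow` (row = 0 modulo its covariance letters, inside `hGrp_of_rows`) — so that the (K)-slot's group datum is ONE kernel statement modulo a NAMED list:
# printed [B5, Prop. 1.2] ∧ [B5, (1.126)–(1.127)]; pins `hlam`∕`hcE`∕`hR`∕`hω`∕`hJ`; the ray `hK`∕`hQ`∕`hx` + `|cgh n| ≤ cgh₀` (P13); the five slot-table sockets + slot-E's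
# support∕scaling; (Λ) sockets + (W1)(W2′)(hX); and NINE open inputs: L-TAD-R ×3, L-GBUB ×3, NK, KN, T₈

HONEST DEPENDENCY (cell records, verbatim): «continuum YM on T⁴ ⇐ BetaPertH ∧ nine spine estimates (0/9 proved); BetaPertH ⇐ (D1) ∧ (D4) ∧
CAP+tail; G-an2-4 gates asym, D1 and NE2/3/4.»  HONEST FRAMING (cell contract, verbatim): «discharging `BetaPertH` makes Bałaban's UV stability
UNCONDITIONAL — a real constructive-QFT result; it is NOT the continuum limit and NOT the Clay problem.»  THIS MODULE DISCHARGES NOTHING of the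
wall: [folklore] wiring BY NAME — `RoadEndBFxRows.hGrp_of_rows` (owner gen 9) fed with `LocalGroupRow.hLoc_of_prop12`, `GluonNeedleRowsT12.h₁_of_prop12 ∕ h₂_of_prop12'`,
`GluonNeedleRowT3.h₃_of_prop12'`, `NeedleRowsAtRay.h₄…h₇_of_ray` (owner gens 9–11 over the swarm's cells: leaf-01, leaf-03-g12∕g13, leaf-04-g8∕g9∕g10, gan24-leaf-05-g41∕g42).
No `def`, no `def … : Prop`, nothing cited, 0 sorry; EVERY remaining input is a displayed HYPOTHESIS.  Root-level binders hW ∕ hR-sockets ∕ hSX-socket ∕ D1Tel ∕ D1Rep — 0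
discharged; (K) NOT closed (nine open inputs + letters listed); NOT D1, NOT `BetaPertH`, NOT continuum, NOT Clay.

ABSOLUTE RULE (cell charter, verbatim): «No internally-minted statement may enter as a cited fact. Every hypothesis is either kernel-proved in
this package or a verbatim quotation of a PUBLISHED theorem with page reference. The manuscript(s) under audit are NOT citable for their own
disputed steps — they are the thing under adjudication; programme-internal (2001/route/tribunal) claims are never citable.»

CONTENT.
* §2 (v1.1) [folklore] **`hGrp_of_prop12'`** — the same with slot R as SOCKETS (`LocalGroupRow.hLoc_of_prop12'`) and NK∕KN supplied (`GluonNeedleRowT3.h₃_of_prop12''`): remaining open inputs `hGbub` ×3, `h₈`.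
* §1 [folklore] **`hGrp_of_prop12`** — `∃ CG : Fin 4 → ℝ, ∀ n ≥ 2, ∀ g ≠ 3, |Σ_{b ∈ image resSite} n⁻⁴·fullSum (w ↦ Σ_{τ : grpRec τ = g} restK′ … τ w)| ≤ CG g`.
NOT HERE (honest): the nine open inputs; the END theorem itself and its root-level binders.
Unit `b2b-balaban-beta-d1-p2` (gen 11), road «BF-x» OWNER; `LEAVES-BFx.md` row «END-WIRE».
-/

noncomputable section

open Finset Filter Topology
open scoped BigOperators
open Literature.MathematicalPhysics.QuantumFieldTheory.Balaban1983to89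
open Literature.MathematicalPhysics.QuantumFieldTheory.Balaban1983to89.Beta
open WindowIdentification (fullSum)
open B12Sec2to5 (l1)
open DyadicShell (Pt toReal supNorm)
open ExpKernelCalculus (Site MKer BiLoc comp shiftK Zl)
open DressedMomentNormalisation (resSite)
open AffineAveraging (unitVec)
open VectorTailsLoc (fam kfam)
open PoissonInterior (nrm)
open OneStepResolventKernel (KInv)
open InterLevelTransport (onLat)
open BalabanStepJets (lamCoeffOf)
open AveragingHessianKernels (hessFF)
open KernelWard (divV)
open Summit.QuantumFields.BalabanUV.Beta.TameKernelCalculus (Spr Loc trK)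
open Summit.QuantumFields.BalabanUV.Beta.D1BFx.GluonLeg (Ga)
open Summit.QuantumFields.BalabanUV.Beta.D1BFx.GluonLegTails (spr_Ga_of_prop12)
open Summit.QuantumFields.BalabanUV.Beta.D1BFx.FrozenLegTails (nOf MOf hn1)
open Summit.QuantumFields.BalabanUV.Beta.D1BFx.GhostLeg (Ggh)
open Summit.QuantumFields.BalabanUV.Beta.D1BFx.RProjector (Pgt)
open Summit.QuantumFields.BalabanUV.Beta.D1BFx.RProjectorJet (RG)
open Summit.QuantumFields.BalabanUV.Beta.D1BFx.ReducedKernel (TableR)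
open Summit.QuantumFields.BalabanUV.Beta.D1BFx.FineHessianSectors (slotWt slotTab)
open Summit.QuantumFields.BalabanUV.Beta.D1BFx.DressedTadpoleTable (tadpoleTable)
open Summit.QuantumFields.BalabanUV.Beta.D1BFx.FineStencilBF (ffOf)
open Summit.QuantumFields.BalabanUV.Beta.D1BFx.FineStencilBFBalaban (SbfBal)
open Summit.QuantumFields.BalabanUV.Beta.D1BFx.SectorRecut (SbT)
open Summit.QuantumFields.BalabanUV.Beta.D1BFx.GluonNeedleSplit (dipPiece ndlPiece)
open Summit.QuantumFields.BalabanUV.Beta.D1BFx.GluonNeedleGlue (cellSum)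
open Summit.QuantumFields.BalabanUV.Beta.D1BFx.FrozenLegProfile (gfrz)
open Summit.QuantumFields.BalabanUV.Beta.D1BFx.SplitInstance (RestIdx)
open Summit.QuantumFields.BalabanUV.Beta.D1BFx.SplitRecut (restK')
open Summit.QuantumFields.BalabanUV.Beta.D1BFx.RankOneBubble (applyK pairing)
open Summit.QuantumFields.BalabanUV.Beta.D1BFx.RankOneBubbleJets (grad)
open Summit.QuantumFields.BalabanUV.Beta.D1BFx.RoadEndBFxRows (grpRec cgRec localFibre hGrp_of_rows)
open Summit.QuantumFields.BalabanUV.Beta.D1BFx.LocalGroupRow (hLoc_of_prop12)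
open Summit.QuantumFields.BalabanUV.Beta.D1BFx.NeedleRowsAtRay (h₄_of_ray h₅_of_ray h₆_of_ray h₇_of_ray)
open Summit.QuantumFields.BalabanUV.Beta.D1BFx.GluonNeedleRowsT12 (h₁_of_prop12 h₂_of_prop12')
open Summit.QuantumFields.BalabanUV.Beta.D1BFx.GluonNeedleRowT3 (h₃_of_prop12')

namespace Summit.QuantumFields.BalabanUV.Beta.D1BFx.RoadEndGroups

variable {a N cgh₀ : ℝ} {μ ν : Fin 4} {cE cVH cΛ cR cK cQ cE₂ cJ4 cΛ₂ cR₂ cQ₂ x₀ ωgl ωgh cgh : ℕ → ℝ} {WE WJ WΛ WR WQ : ℕ → TableR}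
  {CE CJ CΛt CRt CQ δW : ℕ → ℝ}
  {TΛ WA : ℕ → Fin 4 → Site 4 → Fin 4 → Site 4 → MKer 4 (Fin 4)} {CT δT : ℕ → ℝ}
  {ε : ℕ → ℝ} {X : ℕ → Site 4 → MKer 4 (Fin 4)} {Cx δx : ℕ → ℝ}

/-- [folklore] **«END-WIRE»: THE GROUP HYPOTHESIS `hGrp` OF THE END OF RECORD FOR THE LABEL OF RECORD, FROM THE TREE's THREE GROUP ROWS.**  Displayed and NOT
proved here: the ENDs' common data (`0 < a`, `μ ≠ ν`, the five slot tables bi-localised at rate `δW n`), the printed statements [B5, Prop. 1.2] ∧ [B5, (1.126)–(1.127)]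
BY NAME, the pins `hlam`∕`hcE`∕`hRsgn`∕`hω`∕`hJ4`, the ray `hK`∕`hQr`∕`hx` with the scalar letter `hcgh : |cgh n| ≤ cgh₀` (P13); (LOCAL) slot-E's support radius `ρE`,
rate floor `δ₀ ≤ δW n` and scaling letter `hkE`, and the SIX open word bounds `hTadR` (L-TAD-R), `hGbub` (L-GBUB); (Λ) the Λ₂-slot sockets `hdec`∕`hTloc`∕`hWAa`∕`hWAl`∕`hTcov`,
`cΛ ≠ 0`, `ε = ±1`, `hX`, the covariance letters (W1), (W2′); (N) the two cells `hNK`∕`hKN` (auxiliary-weight form) and the slot-4 tadpole row `h₈` (T₈).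
Conclusion: `hGrp` of `RoadEndBFxTotalShellGroups.d1Drift_BFx_total_shell_of_prop12_of_groups` at `grp := grpRec`, `g₀ := 3`, with an EXISTENTIAL constant vector. -/
theorem hGrp_of_prop12 (ha : 0 < a) (hμν : μ ≠ ν)
    (h12 : B5.Prop12Printed (fam nOf hn1 MOf a ha)) (h126 : B5.Kernel126_127Printed (kfam nOf MOf))
    (hlam : ∀ n : ℕ, 2 ≤ n → ωgl n * cE n ^ 2 = 2 * N ^ 2 * (n : ℝ) ^ 8) (hcE : ∀ n : ℕ, 2 ≤ n → cE n = (n : ℝ) ^ 4)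
    (hRsgn : ∀ n : ℕ, 2 ≤ n → cR n = -cE n) (hω : ∀ n : ℕ, 2 ≤ n → ωgh n * cK n ^ 2 = -2 * (ωgl n * cE n ^ 2)) (hJ4 : ∀ n : ℕ, cJ4 n = 0)
    (hcgh : ∀ n : ℕ, |cgh n| ≤ cgh₀) (hK : ∀ n : ℕ, cK n = cgh n * (n : ℝ) ^ 2) (hQr : ∀ n : ℕ, cQ n = cgh n * a) (hx : ∀ n : ℕ, x₀ n = -cgh n)
    (hδW : ∀ n, 0 < δW n)
    (hE : ∀ n κ u l u', BiLoc (WE n κ u l u') u u' (CE n) (δW n)) (hJ : ∀ n κ u l u', BiLoc (WJ n κ u l u') u u' (CJ n) (δW n))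
    (hΛ : ∀ n κ u l u', BiLoc (WΛ n κ u l u') u u' (CΛt n) (δW n)) (hR : ∀ n κ u l u', BiLoc (WR n κ u l u') u u' (CRt n) (δW n))
    (hQ : ∀ n κ u l u', BiLoc (WQ n κ u l u') u u' (CQ n) (δW n))
    -- (LOCAL) slot-E's support and scaling; the six open words
    {ρE : ℕ} {δ₀ kE : ℝ} (hδ₀ : 0 < δ₀) (hδE : ∀ n, δ₀ ≤ δW n)
    (hsuppE : ∀ n κ u l u', ρE < supNorm (u - u') → WE n κ u l u' = 0)
    (hkE : ∀ n : ℕ, 2 ≤ n → |ωgl n * cE₂ n| * CE n ≤ kE * (n : ℝ) ^ 8)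
    {CR : Fin 3 → ℝ}
    (hTadR : ∀ (r : Fin 3) (n : ℕ), 2 ≤ n → ∀ [NeZero n],
      |∑ b ∈ (univ : Finset (Fin 4 → Fin n)).image resSite, ((n : ℝ) ^ 4)⁻¹ *
        fullSum (fun w : Pt => restK' n a (gfrz n a b) (cE n) (cΛ n) (cR n) (cK n) (cQ n) (cE₂ n) (cJ4 n) (cΛ₂ n) (cR₂ n) (cQ₂ n) (x₀ n)
          (WE n) (WJ n) (WΛ n) (WR n) (WQ n) (ωgl n) (ωgh n) ((n : ℝ) ^ 8) N μ ν b (Sum.inl ((3 : Fin 5), r)) w)| ≤ CR r)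
    {CG : Fin 2 → Fin 2 → ℝ}
    (hGbub : ∀ (r r' : Fin 2), ¬(r = 0 ∧ r' = 0) → ∀ n : ℕ, 2 ≤ n → ∀ [NeZero n],
      |∑ b ∈ (univ : Finset (Fin 4 → Fin n)).image resSite, ((n : ℝ) ^ 4)⁻¹ *
        fullSum (fun w : Pt => restK' n a (gfrz n a b) (cE n) (cΛ n) (cR n) (cK n) (cQ n) (cE₂ n) (cJ4 n) (cΛ₂ n) (cR₂ n) (cQ₂ n) (x₀ n)
          (WE n) (WJ n) (WΛ n) (WR n) (WQ n) (ωgl n) (ωgh n) ((n : ℝ) ^ 8) N μ ν b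
            (Sum.inr (Sum.inr (Sum.inr (Sum.inl ((0 : Fin 2), (0 : Fin 2), r, r'))))) w)| ≤ CG r r')
    -- (Λ) the Λ₂-slot structure sockets and the zero-momentum data, along `n` (as in `hGrp_of_rows`)
    (hδT : ∀ n, 0 < δT n)
    (hdec : ∀ n : ℕ, 2 ≤ n → ∀ [NeZero n], ∀ κ u l u', WΛ n κ u l u' =
      (∑ m : Fin 4, OneStepResolventKernel.wsum (onLat n (fun y => lamCoeffOf (KInv (N := n) (d := 3)) n m y l u'))
          (fun v => onLat n (fun y => TΛ n m y κ u) v))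
      + (∑ m : Fin 4, OneStepResolventKernel.wsum (onLat n (fun y => lamCoeffOf (KInv (N := n) (d := 3)) n m y κ u))
          (fun v => onLat n (fun y => TΛ n m y l u') v))
      + WA n κ u l u')
    (hTloc : ∀ (n : ℕ) m y κ u, BiLoc (TΛ n m y κ u) ((n : ℤ) • y) ((n : ℤ) • y) (CT n * Real.exp (-δT n * l1 ((n : ℤ) • y - u))) (δT n))
    (hWAa : ∀ n κ u l u', trK (WA n κ u l u') = -WA n κ u l u') (hWAl : ∀ n κ u l u', Loc (WA n κ u l u'))
    (hTcov : ∀ (n : ℕ) m y κ u t, TΛ n m (y + t) κ (u + (n : ℤ) • t) = shiftK (-((n : ℤ) • t)) (TΛ n m y κ u))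
    (hcΛ : ∀ n : ℕ, 2 ≤ n → cΛ n ≠ 0) (hε : ∀ n : ℕ, ε n = 1 ∨ ε n = -1) (hδx : ∀ n, 0 < δx n) (hX : ∀ n u, BiLoc (X n u) u u (Cx n) (δx n))
    (hW1 : ∀ n : ℕ, 2 ≤ n → ∀ [NeZero n], ∀ u,
      comp (comp (Ga n a) (divV (fun κ v => ε n • SbfBal n a (cE n) (cVH n) (cΛ n) (cR n) (cK n) (cQ n) κ v) u)) (Ga n a) =
        comp (Ga n a) (X n u) - comp (X n u) (Ga n a))
    (hW2 : ∀ n : ℕ, 2 ≤ n → ∀ [NeZero n], ∀ (m : Fin 4) (u : Site 4),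
      divV (fun κ v => (-(ε n * (cΛ₂ n / cΛ n))) • TΛ n m 0 κ v) u = comp (X n u) (ffOf (hessFF n m 0)) - comp (ffOf (hessFF n m 0)) (X n u))
    -- (N) the two cells and the slot-4 tadpole row
    (hNK : ∃ C : ℝ, 0 ≤ C ∧ ∀ (n : ℕ) [NeZero n], |cgh₀ * (n : ℝ) ^ 2 * cellSum n a (ndlPiece n a (cQ n)) (dipPiece n a) μ ν| ≤ C)
    (hKN : ∃ C : ℝ, 0 ≤ C ∧ ∀ (n : ℕ) [NeZero n], |cgh₀ * (n : ℝ) ^ 2 * cellSum n a (dipPiece n a) (ndlPiece n a (cQ n)) μ ν| ≤ C)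
    {C₈ : ℝ}
    (h₈ : ∀ n : ℕ, 2 ≤ n → ∀ [NeZero n], |ωgl n * cQ₂ n * ∑ b ∈ (univ : Finset (Fin 4 → Fin n)).image resSite, ((n : ℝ) ^ 4)⁻¹ * (((n : ℝ) ^ 8)⁻¹ *
      fullSum (fun w : Pt => toReal w μ * toReal w ν * tadpoleTable n a (WQ n) μ ν (b + w) b))| ≤ C₈) :
    ∃ CGv : Fin 4 → ℝ, ∀ n : ℕ, 2 ≤ n → ∀ [NeZero n], ∀ g : Fin 4, g ≠ 3 →
      |∑ b ∈ (univ : Finset (Fin 4 → Fin n)).image resSite, ((n : ℝ) ^ 4)⁻¹ *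
        fullSum (fun w : Pt => ∑ τ ∈ (univ : Finset RestIdx).filter (fun τ => grpRec τ = g),
          restK' n a (gfrz n a b) (cE n) (cΛ n) (cR n) (cK n) (cQ n) (cE₂ n) (cJ4 n) (cΛ₂ n) (cR₂ n) (cQ₂ n) (x₀ n)
            (WE n) (WJ n) (WΛ n) (WR n) (WQ n) (ωgl n) (ωgh n) ((n : ℝ) ^ 8) N μ ν b τ w)| ≤ CGv g := by
  have hGa : ∀ n : ℕ, 2 ≤ n → ∀ [NeZero n], Spr (Ga n a) := fun n _ _ => spr_Ga_of_prop12 (a := a) (ha := ha) h12 h126 n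
  -- (LOCAL)
  have hWE : ∀ n κ u l u', BiLoc (slotTab (WE n) (WJ n) (WΛ n) (WR n) (WQ n) 0 κ u l u') u u' (CE n) (δW n) := fun n κ u l u' => hE n κ u l u'
  have hsuppE' : ∀ n κ u l u', ρE < supNorm (u - u') → slotTab (WE n) (WJ n) (WΛ n) (WR n) (WQ n) 0 κ u l u' = 0 :=
    fun n κ u l u' h => hsuppE n κ u l u' h
  have hkE' : ∀ n : ℕ, 2 ≤ n → |ωgl n * slotWt (cE₂ n) (cJ4 n) (cΛ₂ n) (cR₂ n) (cQ₂ n) 0| * CE n ≤ kE * (n : ℝ) ^ 8 := fun n hn => hkE n hn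
  obtain ⟨CL, hLoc⟩ := hLoc_of_prop12 (N := N) (cΛ := cΛ) (cR := cR) (cK := cK) (cQ := cQ) (cΛ₂ := cΛ₂) (cR₂ := cR₂) (cQ₂ := cQ₂) (x₀ := x₀) (ωgh := ωgh)
    (WJ := WJ) (WΛ := WΛ) (WR := WR) (WQ := WQ) (μ := μ) (ν := ν) ha h12 h126 hlam hJ4 hδ₀ hδE hWE hsuppE' hkE' hTadR hGbub
  -- (N)
  obtain ⟨C₁, _, h₁⟩ := h₁_of_prop12 (N := N) (cE := cE) (cR := cR) (cK := cK) (cQ := cQ) (ωgl := ωgl) ha h12 h126 hlam hcE hRsgn hcgh hK hQr μ ν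
  obtain ⟨C₂, _, h₂⟩ := h₂_of_prop12' (N := N) (cE := cE) (cR := cR) (cK := cK) (cQ := cQ) (ωgl := ωgl) ha h12 h126 hlam hcE hRsgn hcgh hK hQr μ ν
  obtain ⟨C₃, _, h₃⟩ := h₃_of_prop12' (N := N) (cE := cE) (cR := cR) (cK := cK) (cQ := cQ) (ωgl := ωgl) ha h12 h126 hlam hcE hRsgn hcgh hK hQr μ ν hNK hKN
  have h₄ := h₄_of_ray (ωgh := ωgh) ha hω hlam hK hQr μ ν
  have h₅ := h₅_of_ray (ωgh := ωgh) ha hω hlam hK hQr μ ν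
  have h₆ := h₆_of_ray (ωgh := ωgh) ha hω hlam hK hQr μ ν
  have h₇ := h₇_of_ray (ωgh := ωgh) ha hω hlam hK hQr hx μ ν
  exact ⟨_, hGrp_of_rows ha hμν hGa hδW hE hJ hΛ hR hQ hLoc hδT hdec hTloc hWAa hWAl hTcov hcΛ hε hδx hX hW1 hW2 h₁ h₂ h₃ h₄ h₅ h₆ h₇ h₈⟩

/-! ## §2 (v1.1, APPENDED 2026-08-21 after «L-WIRE» v1.1 p281044, «GN-WIRE∕T₃» v1.2 and leaf-01's NK∕KN) The END's `hGrp` with slot R's words as sockets and all fifteen gluon cells supplied -/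

open Summit.QuantumFields.BalabanUV.Beta.D1BFx.LocalGroupRow (hLoc_of_prop12') in
open Summit.QuantumFields.BalabanUV.Beta.D1BFx.GluonNeedleRowT3 (h₃_of_prop12'') in
/-- [folklore] **«END-WIRE» v1.1: THE GROUP HYPOTHESIS `hGrp` OF THE END OF RECORD WITH THE GLUON NEEDLE ROWS FULLY SUPPLIED AND SLOT R AS SOCKETS** — as `hGrp_of_prop12`
but (LOCAL) through `LocalGroupRow.hLoc_of_prop12'` (the three slot-R tadpoles from leaf-04-g10's `LocalTadpoleRowsDecay` via slot R's displayed envelope `hWR` + units line `hkR`) and (N)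
through `GluonNeedleRowT3.h₃_of_prop12''` (NK∕KN = leaf-01's cells).  REMAINING displayed inputs beyond the END's own data, the pins, the ray + `hcgh` (P13), the slot sockets and the (Λ)
data: the three local ghost bubbles `hGbub` («L-GBUB»: NOT suppliable under reading (i) of `hω` — owner rulings ρ-g11-4∕8, Q-GU-1′) and the slot-4 tadpole row `h₈` (T₈: `WQ` awaits (A2)). -/
theorem hGrp_of_prop12' (ha : 0 < a) (hμν : μ ≠ ν)
    (h12 : B5.Prop12Printed (fam nOf hn1 MOf a ha)) (h126 : B5.Kernel126_127Printed (kfam nOf MOf))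
    (hlam : ∀ n : ℕ, 2 ≤ n → ωgl n * cE n ^ 2 = 2 * N ^ 2 * (n : ℝ) ^ 8) (hcE : ∀ n : ℕ, 2 ≤ n → cE n = (n : ℝ) ^ 4)
    (hRsgn : ∀ n : ℕ, 2 ≤ n → cR n = -cE n) (hω : ∀ n : ℕ, 2 ≤ n → ωgh n * cK n ^ 2 = -2 * (ωgl n * cE n ^ 2)) (hJ4 : ∀ n : ℕ, cJ4 n = 0)
    (hcgh : ∀ n : ℕ, |cgh n| ≤ cgh₀) (hK : ∀ n : ℕ, cK n = cgh n * (n : ℝ) ^ 2) (hQr : ∀ n : ℕ, cQ n = cgh n * a) (hx : ∀ n : ℕ, x₀ n = -cgh n)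
    (hδW : ∀ n, 0 < δW n)
    (hE : ∀ n κ u l u', BiLoc (WE n κ u l u') u u' (CE n) (δW n)) (hJ : ∀ n κ u l u', BiLoc (WJ n κ u l u') u u' (CJ n) (δW n))
    (hΛ : ∀ n κ u l u', BiLoc (WΛ n κ u l u') u u' (CΛt n) (δW n)) (hR : ∀ n κ u l u', BiLoc (WR n κ u l u') u u' (CRt n) (δW n))
    (hQ : ∀ n κ u l u', BiLoc (WQ n κ u l u') u u' (CQ n) (δW n))
    -- (LOCAL) slot-E support∕units; slot-R envelope∕units; the three open ghost words
    {ρE : ℕ} {δ₀ kE : ℝ} (hδ₀ : 0 < δ₀) (hδE : ∀ n, δ₀ ≤ δW n)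
    (hsuppE : ∀ n κ u l u', ρE < supNorm (u - u') → WE n κ u l u' = 0)
    (hkE : ∀ n : ℕ, 2 ≤ n → |ωgl n * cE₂ n| * CE n ≤ kE * (n : ℝ) ^ 8)
    {CwR δR : ℕ → ℝ} {θR δ₀R kR : ℝ} (hθR : 0 < θR) (hδR : ∀ n, 0 < δR n) (hδ₀R : 0 < δ₀R) (hδRge : ∀ n : ℕ, δ₀R / n ≤ δR n) (hCwR : ∀ n, 0 ≤ CwR n)
    (hWR : ∀ n κ u l u', BiLoc (WR n κ u l u') u u' (CwR n * Real.exp (-(θR / n) * supNorm (u - u'))) (δR n))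
    (hkR : ∀ n : ℕ, 2 ≤ n → |ωgl n * cR₂ n| * CwR n * (n : ℝ) ^ 6 ≤ kR)
    {CG : Fin 2 → Fin 2 → ℝ}
    (hGbub : ∀ (r r' : Fin 2), ¬(r = 0 ∧ r' = 0) → ∀ n : ℕ, 2 ≤ n → ∀ [NeZero n],
      |∑ b ∈ (univ : Finset (Fin 4 → Fin n)).image resSite, ((n : ℝ) ^ 4)⁻¹ *
        fullSum (fun w : Pt => restK' n a (gfrz n a b) (cE n) (cΛ n) (cR n) (cK n) (cQ n) (cE₂ n) (cJ4 n) (cΛ₂ n) (cR₂ n) (cQ₂ n) (x₀ n)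
          (WE n) (WJ n) (WΛ n) (WR n) (WQ n) (ωgl n) (ωgh n) ((n : ℝ) ^ 8) N μ ν b
            (Sum.inr (Sum.inr (Sum.inr (Sum.inl ((0 : Fin 2), (0 : Fin 2), r, r'))))) w)| ≤ CG r r')
    -- (Λ) sockets and zero-momentum data
    (hδT : ∀ n, 0 < δT n)
    (hdec : ∀ n : ℕ, 2 ≤ n → ∀ [NeZero n], ∀ κ u l u', WΛ n κ u l u' =
      (∑ m : Fin 4, OneStepResolventKernel.wsum (onLat n (fun y => lamCoeffOf (KInv (N := n) (d := 3)) n m y l u'))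
          (fun v => onLat n (fun y => TΛ n m y κ u) v))
      + (∑ m : Fin 4, OneStepResolventKernel.wsum (onLat n (fun y => lamCoeffOf (KInv (N := n) (d := 3)) n m y κ u))
          (fun v => onLat n (fun y => TΛ n m y l u') v))
      + WA n κ u l u')
    (hTloc : ∀ (n : ℕ) m y κ u, BiLoc (TΛ n m y κ u) ((n : ℤ) • y) ((n : ℤ) • y) (CT n * Real.exp (-δT n * l1 ((n : ℤ) • y - u))) (δT n))
    (hWAa : ∀ n κ u l u', trK (WA n κ u l u') = -WA n κ u l u') (hWAl : ∀ n κ u l u', Loc (WA n κ u l u'))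
    (hTcov : ∀ (n : ℕ) m y κ u t, TΛ n m (y + t) κ (u + (n : ℤ) • t) = shiftK (-((n : ℤ) • t)) (TΛ n m y κ u))
    (hcΛ : ∀ n : ℕ, 2 ≤ n → cΛ n ≠ 0) (hε : ∀ n : ℕ, ε n = 1 ∨ ε n = -1) (hδx : ∀ n, 0 < δx n) (hX : ∀ n u, BiLoc (X n u) u u (Cx n) (δx n))
    (hW1 : ∀ n : ℕ, 2 ≤ n → ∀ [NeZero n], ∀ u,
      comp (comp (Ga n a) (divV (fun κ v => ε n • SbfBal n a (cE n) (cVH n) (cΛ n) (cR n) (cK n) (cQ n) κ v) u)) (Ga n a) =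
        comp (Ga n a) (X n u) - comp (X n u) (Ga n a))
    (hW2 : ∀ n : ℕ, 2 ≤ n → ∀ [NeZero n], ∀ (m : Fin 4) (u : Site 4),
      divV (fun κ v => (-(ε n * (cΛ₂ n / cΛ n))) • TΛ n m 0 κ v) u = comp (X n u) (ffOf (hessFF n m 0)) - comp (ffOf (hessFF n m 0)) (X n u))
    -- (N) the slot-4 tadpole row
    {C₈ : ℝ}
    (h₈ : ∀ n : ℕ, 2 ≤ n → ∀ [NeZero n], |ωgl n * cQ₂ n * ∑ b ∈ (univ : Finset (Fin 4 → Fin n)).image resSite, ((n : ℝ) ^ 4)⁻¹ * (((n : ℝ) ^ 8)⁻¹ *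
      fullSum (fun w : Pt => toReal w μ * toReal w ν * tadpoleTable n a (WQ n) μ ν (b + w) b))| ≤ C₈) :
    ∃ CGv : Fin 4 → ℝ, ∀ n : ℕ, 2 ≤ n → ∀ [NeZero n], ∀ g : Fin 4, g ≠ 3 →
      |∑ b ∈ (univ : Finset (Fin 4 → Fin n)).image resSite, ((n : ℝ) ^ 4)⁻¹ *
        fullSum (fun w : Pt => ∑ τ ∈ (univ : Finset RestIdx).filter (fun τ => grpRec τ = g),
          restK' n a (gfrz n a b) (cE n) (cΛ n) (cR n) (cK n) (cQ n) (cE₂ n) (cJ4 n) (cΛ₂ n) (cR₂ n) (cQ₂ n) (x₀ n)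
            (WE n) (WJ n) (WΛ n) (WR n) (WQ n) (ωgl n) (ωgh n) ((n : ℝ) ^ 8) N μ ν b τ w)| ≤ CGv g := by
  have hGa : ∀ n : ℕ, 2 ≤ n → ∀ [NeZero n], Spr (Ga n a) := fun n _ _ => spr_Ga_of_prop12 (a := a) (ha := ha) h12 h126 n
  -- (LOCAL): slots E and R in the `slotTab`∕`slotWt` currency of `LocalGroupRow` (defeq)
  have hWE : ∀ n κ u l u', BiLoc (slotTab (WE n) (WJ n) (WΛ n) (WR n) (WQ n) 0 κ u l u') u u' (CE n) (δW n) := fun n κ u l u' => hE n κ u l u'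
  have hsuppE' : ∀ n κ u l u', ρE < supNorm (u - u') → slotTab (WE n) (WJ n) (WΛ n) (WR n) (WQ n) 0 κ u l u' = 0 :=
    fun n κ u l u' h => hsuppE n κ u l u' h
  have hkE' : ∀ n : ℕ, 2 ≤ n → |ωgl n * slotWt (cE₂ n) (cJ4 n) (cΛ₂ n) (cR₂ n) (cQ₂ n) 0| * CE n ≤ kE * (n : ℝ) ^ 8 := fun n hn => hkE n hn
  have hWR' : ∀ n κ u l u', BiLoc (slotTab (WE n) (WJ n) (WΛ n) (WR n) (WQ n) 3 κ u l u') u u' (CwR n * Real.exp (-(θR / n) * supNorm (u - u'))) (δR n) :=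
    fun n κ u l u' => hWR n κ u l u'
  have hkR' : ∀ n : ℕ, 2 ≤ n → |ωgl n * slotWt (cE₂ n) (cJ4 n) (cΛ₂ n) (cR₂ n) (cQ₂ n) 3| * CwR n * (n : ℝ) ^ 6 ≤ kR := fun n hn => hkR n hn
  obtain ⟨CL, hLoc⟩ := hLoc_of_prop12' (N := N) (cΛ := cΛ) (cR := cR) (cK := cK) (cQ := cQ) (cΛ₂ := cΛ₂) (cR₂ := cR₂) (cQ₂ := cQ₂) (x₀ := x₀) (ωgh := ωgh)
    (WJ := WJ) (WΛ := WΛ) (WR := WR) (WQ := WQ) (μ := μ) (ν := ν) ha h12 h126 hlam hJ4 hδ₀ hδE hWE hsuppE' hkE' hθR hδR hδ₀R hδRge hCwR hWR' hkR' hGbub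
  -- (N)
  obtain ⟨C₁, _, h₁⟩ := h₁_of_prop12 (N := N) (cE := cE) (cR := cR) (cK := cK) (cQ := cQ) (ωgl := ωgl) ha h12 h126 hlam hcE hRsgn hcgh hK hQr μ ν
  obtain ⟨C₂, _, h₂⟩ := h₂_of_prop12' (N := N) (cE := cE) (cR := cR) (cK := cK) (cQ := cQ) (ωgl := ωgl) ha h12 h126 hlam hcE hRsgn hcgh hK hQr μ ν
  obtain ⟨C₃, _, h₃⟩ := h₃_of_prop12'' (N := N) (cE := cE) (cR := cR) (cK := cK) (cQ := cQ) (ωgl := ωgl) ha h12 h126 hlam hcE hRsgn hcgh hK hQr μ ν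
  have h₄ := h₄_of_ray (ωgh := ωgh) ha hω hlam hK hQr μ ν
  have h₅ := h₅_of_ray (ωgh := ωgh) ha hω hlam hK hQr μ ν
  have h₆ := h₆_of_ray (ωgh := ωgh) ha hω hlam hK hQr μ ν
  have h₇ := h₇_of_ray (ωgh := ωgh) ha hω hlam hK hQr hx μ ν
  exact ⟨_, hGrp_of_rows ha hμν hGa hδW hE hJ hΛ hR hQ hLoc hδT hdec hTloc hWAa hWAl hTcov hcΛ hε hδx hX hW1 hW2 h₁ h₂ h₃ h₄ h₅ h₆ h₇ h₈⟩

end Summit.QuantumFields.BalabanUV.Beta.D1BFx.RoadEndGroups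

end
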